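import Summits.HodgeConjecture.HodgeConjecture.Theorems.R90S9DefiniteXiMembershipCut      -- ★ p861479 (p04): the (AE) clause currency of `hRig` (D6: `cmSplitPacket`, `splitWitness`, `KeysCaseTwoLabels`, `cmDatumLocalCongr`, `localPiEquiv`)
import Summits.HodgeConjecture.HodgeConjecture.Theorems.R90S5EvpOfAeRouting             -- ★ p861517 (S5): `evp_eq_record_of_ae_routesAt` for EVERY hermitian `H`; brings ★ `RoutesAt`, `clFinChoice`, `xiFamilyOfRecord`, E1 `evpAtIntegralLevel`, the rung-0 Haar ∕ Keys suppliers
import Summits.HodgeConjecture.HodgeConjecture.Theorems.R90S5HasFinComponentOfDiscrete    -- ★ (K2E1-p12): `R90.S5.admUnitConstituents_nonempty_of_anisotropic` (AFA at anisotropic `H`, ★ p861871, read back as constituent supply)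
import HarnessLib

/-!
# R90-TF · S9 «InnerForm-13.3.6 (c)» — THE E1 STRING PIN OF THE (AE-ⅱ) CUT, DISCHARGED: (AE) ⟹ `t(P) = t(⊗_v πⁿ(ξ_v))` at an ANISOTROPIC `H`
# (Rogawski 1990, §13.6 p. 209 «`π` unramified off `S` defines an e.v.p. `t(π)`»; §14.6 p. 242 «`t_{S′}` … can be regarded as an e.v.p. on either `G′` or `G`»; Thm. 14.6.4 proof l. 1, p. 243)

Cell `hodgecm-mathlib`, crux H413 (`stmt-HodgeConjecture-24833`, lane `--supports … --as helper`), route of record `HCCMUnconditional` (no route verbs; count-neutral).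
Programme R90-TF (brief `director/R90-BRIEF.v2.md` 1f40d54518340a35), section S9 = InnerForm-13.3.6 (c) (base `R90-IF`); seat R90-IF-p06 (g0), deal «EMIT S9 WAVE 2» p06 → (AE-ⅱ)
JUNCTION CUT — SEQUEL #1: the pin `hstring : (AE) → ‹E1 string›` of the engine ★∕pending `definiteAeRigidityAt_of_parts` (`Theorems/R90S9DefiniteAeRigidityCutEngine.lean`, this seat)
is PROVED here for every ANISOTROPIC `H` (the locus of (B4), guard `hanis`) and every auxiliary `μ` with `μ|𝕀_{L⁺} = ω_{L/L⁺}` (`hμω`, (B4)'s binder) — so the HEAD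
`definiteAeRigidity_of_parts` (`Theorems/R90S9DefiniteAeRigidityCut.lean`) no longer carries it.  THEOREMS ONLY (no `def`, no instance, no notation, no named fact, no `sorry`).
HONEST LABEL: HC_CM is proved only modulo the 7 printed citations (2 remaining named inputs: hLiu418 = stmt-HodgeConjecture-24832, h413 = stmt-HodgeConjecture-24833) — until
rung 0 closes.  A book-keeping lemma in E1 currency: no leaf moves; REL ≠ ★ ≠ BUILT.

THE MATHEMATICS.  (AE) says: off a finite `S`, at every NON-SPLIT `v` every `v`-constituent of `P` is Keys' non-`L²` label `πⁿ(ξ_v)` transported along every form congruence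
`e⁻¹ = cmDatumLocalCongr L v T ha h`, and at every SPLIT `v` every `v`-constituent lies in the (singleton, ★ `cmSplitPacket_members`) split packet `{i_G(ξ_v ⊗ μ_w ∘ det₀)}`.  At an
anisotropic `H` every discrete `P` HAS an admissible unitarizable constituent at every `v` (★ `R90.S5.admUnitConstituents_nonempty_of_anisotropic` ⟸ «AFA» ★
`R90.S9.automorphicFlathAdmissible_of_anisotropic`, Godement compactness + Flath), so the chosen class ★ `clFinChoice P v` IS a constituent (★ `clFinChoice_isConstituentOf_of_nonempty`)
and (AE) ROUTES `P` by `ξ` off `S` (★ `RoutesAt`, for the rung-0 Haar family on the `U(Φ₃)(L⁺_v)⧸Z` ★ `exists_isHaarMeasure_gqs_quotient_center` and Keys' labelled pairs ★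
`exists_keysData_of_keysCaseTwo` — HYPOTHESIS-FREE via ★ `keysCaseTwo_of_stubs` + ★ `keysCaseTwoReducible_holds` + ★ `u3SquareIntegrableExponents_holds` at ★
`isQuadraticCharExtension_semilocalComponent_of_baseChange_eq hμω`, exactly as ★ `R90.S5.xiString_…_of_baseChange` chooses them).  Then ★ `R90.S5.evp_eq_record_of_ae_routesAt`
(ii): for a finite `S₀` and every `S ⊇ S₀` the E1 eigenvalue packages at the integral levels coincide — print's «`t(P) = t(Π(ξ))`» [§13.6 p. 209; (14.6.2) p. 242].

[cite: Rogawski1990, §13.6 pp. 209–210; §14.6 (14.6.2) p. 242, Thm. 14.6.4 p. 243; §13.1 p. 199; §12.2 (2) pp. 173–174; §14.5 p. 237]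
[cite: FlathCorvallis1979, Thm. 3] [cite: CartierCorvallis1979, §IV.1 Cor. 4.1] [cite: Godement1964, Exp. 257 Thm. 4.2]
-/

set_option autoImplicit false
-- the mandated namespace repeats `HodgeConjecture.HodgeConjecture`, as in every `Theorems/*.lean` of this sub-problem
set_option linter.dupNamespace false

noncomputable section

open NumberField IsDedekindDomain MeasureTheory
open scoped Matrix ComplexOrder

open Literature.NumberTheory Literature.NumberTheory.Automorphic Literature.NumberTheory.Automorphic.UnitaryGroup
open Literature.NumberTheory.Automorphic.IdeleClassGroup
open Literature.NumberTheory.GaloisRepresentations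
open Literature.NumberTheory.Rogawski1990

namespace Summit.HodgeConjecture.HodgeConjecture.R90.S9

open Summit.HodgeConjecture.HodgeConjecture.Cruxes.H413
open Summit.HodgeConjecture.HodgeConjecture.Cruxes.H413.F0P3ClassTokenChoice (clFinChoice admUnitConstituents clFinChoice_isConstituentOf_of_nonempty)
open Summit.HodgeConjecture.HodgeConjecture.Cruxes.H413.F0P3CohClassRoutingCot (RoutesAt)
open Summit.HodgeConjecture.HodgeConjecture.Cruxes.H413.F0P3XiLocalFamilyOfRecord (xiFamilyOfRecord)
open Summit.HodgeConjecture.HodgeConjecture.Cruxes.H413.K2E1EvpOfAutomorphicClass (evpAtIntegralLevel)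

open scoped Classical in
set_option synthInstance.maxHeartbeats 400000 in
set_option maxHeartbeats 8000000 in
/-- **`aeString_of_ae` — (AE) ⟹ THE E1 STRING `t(P) = t(⊗_v πⁿ(ξ_v))`, AT AN ANISOTROPIC `H`.**  For a CM field `L`, a hermitian `H ∈ M₃(L)` with unit determinant and NO
isotropic vector (`hanis`, (B4)'s guard), Rogawski's auxiliary unitary Hecke character `μ` with `μ|𝕀_{L⁺} = ω_{L/L⁺}` (`hμω`), a one-dimensional automorphic `ξ` of `H = U(2) × U(1)`
and a discrete automorphic `P` of `U(H)`: IF (AE) holds (the (AE) clause of ★ `definiteXiMembership_of_ch14`'s `hRig`, BYTE FOR BYTE — off a finite `S`, every non-split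
`v`-constituent of `P` is `πⁿ(ξ_v) ∘ e` for every frame and Keys labels, every split `v`-constituent is the split member), THEN there is a finite `S₀` such that for every `S ⊇ S₀`
the E1 eigenvalue packages of the chosen classes of `P` and of the record family `πⁿ(ξ_v)` at the integral levels `U(H)(𝒪_v)` COINCIDE (★ `evpAtIntegralLevel`; the text (ii) of
★ `R90.S5.evp_eq_record_of_ae_routesAt` READ AT `H`, = the antecedent of the engine's pin `hevp`).  Proof: constituent supply ★ `R90.S5.admUnitConstituents_nonempty_of_anisotropic`
⟹ `clFinChoice P v` is a constituent ⟹ (AE) gives ★ `RoutesAt … P ξ v` off `S` (split: ★ `cmSplitPacket_members` singleton; non-split: the clause at the CHOSEN rung-0 Haar family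
and Keys data) ⟹ ★ `R90.S5.evp_eq_record_of_ae_routesAt`.  No sorry; axioms `propext`, `Classical.choice`, `Quot.sound`.
[cite: Rogawski1990, §13.6 pp. 209–210; §14.6 (14.6.2) p. 242, Thm. 14.6.4 p. 243; §13.1 p. 199; §12.2 (2) pp. 173–174] [cite: FlathCorvallis1979, Thm. 3] [cite: CartierCorvallis1979, §IV.1 Cor. 4.1] -/
theorem aeString_of_ae
    (L : Type) [Field L] [NumberField L] [IsCMField L] (H : Matrix (Fin 3) (Fin 3) L)
    (hH : (H.map (cmConjRingHom L))ᵀ = H) (hHd : IsUnit H.det)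
    (hanis : ∀ x : Fin 3 → L, Literature.AlgebraicGeometry.ShimuraVarieties.hermForm (cmConjRingHom L) H x x = 0 → x = 0)
    (μω : HeckeCharacter L) (hμu : μω.IsUnitary)
    (hμω : ∀ x : Literature.NumberTheory.GaloisRepresentations.ideleGroup ↥(maximalRealSubfield L),
      μω (AdeleRing.ideleBaseChange (↥(maximalRealSubfield L)) L x) = quadraticHeckeCharCM L x)
    (ξ : OneDimAutRepH L)
    (μA : Measure (adelicGroupData (↥(maximalRealSubfield L)) L (IsCMField.complexConj L) 3 H).automorphicQuotient)
    [(adelicGroupData (↥(maximalRealSubfield L)) L (IsCMField.complexConj L) 3 H).IsAutomorphicMeasure μA]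
    (P : DiscreteAutomorphicRep (adelicGroupData (↥(maximalRealSubfield L)) L (IsCMField.complexConj L) 3 H) μA)
    (hAE :
      (∃ S : Finset (HeightOneSpectrum (𝓞 ↥(maximalRealSubfield L))),
        (∀ v : HeightOneSpectrum (𝓞 ↥(maximalRealSubfield L)), v ∉ S →
          ∀ (hns : ∀ w : PlacesOver L v, IsCMField.complexConj L • w.1 = w.1)
            (T : GL (Fin 3) (LocalRing L v)) (a : LocalRing L v) (ha : IsUnit a)
            (h : formCongr (conjLocal L (IsCMField.complexConj L) v) T (H.map (algebraMap L (LocalRing L v))) =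
              a • (Matrix.of fun i j : Fin 3 => if i.val + j.val + 1 = 3 then (1 : L) else 0).map (algebraMap L (LocalRing L v))),
          ∀ [MeasurableSpace (Gqs L v ⧸ Subgroup.center (Gqs L v))] [BorelSpace (Gqs L v ⧸ Subgroup.center (Gqs L v))]
            (μZ : Measure (Gqs L v ⧸ Subgroup.center (Gqs L v))) [μZ.IsHaarMeasure],
          ∀ (π2 πn : IrrClass (Gqs L v)),
            KeysCaseTwoLabels L v (μω.semilocalComponent L v) (torusLocalComponent L (IsCMField.complexConj L) v ξ.η)
              (torusLocalComponent L (IsCMField.complexConj L) v ξ.ψ) π2 πn →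
            ¬ πn.IsSquareIntegrable μZ →
            ∀ c : IrrClass ((cmDatum L 3 H).Local v),
              (IrrClass.comap (localPiEquiv L (IsCMField.complexConj L) 3 H v) c).IsConstituentOf
                  (P.finRep.smoothPart.toRepresentation.comp (inclPlace (↥(maximalRealSubfield L)) L (IsCMField.complexConj L) 3 H v)) →
              c = IrrClass.comap (cmDatumLocalCongr L v T ha h).symm πn) ∧
        (∀ v : HeightOneSpectrum (𝓞 ↥(maximalRealSubfield L)), v ∉ S →
          ∀ (hs : ∃ w : PlacesOver L v, IsCMField.complexConj L • w.1 ≠ w.1),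
            ∀ c : IrrClass ((cmDatum L 3 H).Local v),
              (IrrClass.comap (localPiEquiv L (IsCMField.complexConj L) 3 H v) c).IsConstituentOf
                  (P.finRep.smoothPart.toRepresentation.comp (inclPlace (↥(maximalRealSubfield L)) L (IsCMField.complexConj L) 3 H v)) →
              c ∈ (cmSplitPacket L H hH hHd v (splitWitness v hs) (splitWitness_spec v hs) (ξ.splitν₀ μω (splitWitness v hs).1)
                (ξ.locψ (splitWitness v hs).1) (ξ.norm_splitν₀_apply hμu (splitWitness v hs).1)
                (ξ.continuous_splitν₀ μω (splitWitness v hs).1) (ξ.norm_locψ_apply (splitWitness v hs).1)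
                (ξ.continuous_locψ (splitWitness v hs).1)).members))) :
    (∃ S₀ : Finset (HeightOneSpectrum (𝓞 ↥(maximalRealSubfield L))),
                ∀ (S : Set (HeightOneSpectrum (𝓞 ↥(maximalRealSubfield L)))), (↑S₀ : Set _) ⊆ S →
                  ∀ (hP : ∀ v, v ∉ S → (clFinChoice P v).IsSpherical (cmLocalIntegralLevel L 3 H v))
                    (hξ : ∀ v, v ∉ S → (xiFamilyOfRecord L H hH hHd μω hμu ξ v).πn.IsSpherical (cmLocalIntegralLevel L 3 H v)),
                    evpAtIntegralLevel L 3 H (fun v => clFinChoice P v) S hP =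
                      evpAtIntegralLevel L 3 H (fun v => (xiFamilyOfRecord L H hH hHd μω hμu ξ v).πn) S hξ) := by
  letI : ∀ v : HeightOneSpectrum (𝓞 ↥(maximalRealSubfield L)), MeasurableSpace (Gqs L v ⧸ Subgroup.center (Gqs L v)) := fun v => borel _
  haveI : ∀ v : HeightOneSpectrum (𝓞 ↥(maximalRealSubfield L)), BorelSpace (Gqs L v ⧸ Subgroup.center (Gqs L v)) := fun v => ⟨rfl⟩
  -- the rung-0 Haar family on the `U(Φ₃)(L⁺_v)⧸Z`, chosen (★ `exists_isHaarMeasure_gqs_quotient_center`)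
  have hμZ := fun v : HeightOneSpectrum (𝓞 ↥(maximalRealSubfield L)) => F0P3Rung0HaarPackage.exists_isHaarMeasure_gqs_quotient_center L v
  haveI : ∀ v : HeightOneSpectrum (𝓞 ↥(maximalRealSubfield L)), ((hμZ v).choose).IsHaarMeasure := fun v => (hμZ v).choose_spec
  -- Keys' labelled pairs, chosen (★ NF1 `KeysCaseTwo` hypothesis-free, at the local quadratic-extension property of `μ`)
  have hK : KeysCaseTwo L := F0P3KeysCaseTwoOfStubs.keysCaseTwo_of_stubs L (F0P2oLocalLettersHold.keysCaseTwoReducible_holds L)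
    (F0P3U3SquareIntegrableExponentsHolds.u3SquareIntegrableExponents_holds L)
  have hkeys := F0P3XiPacketFamilyOfRecord.exists_keysData_of_keysCaseTwo L μω hK (fun v => (hμZ v).choose)
    (fun v _ => isQuadraticCharExtension_semilocalComponent_of_baseChange_eq μω hμω v)
  -- at an anisotropic `H` every discrete `P` has an admissible unitarizable constituent at every `v` («AFA» ★), so `clFinChoice P v` is a constituent
  have hcons : ∀ v : HeightOneSpectrum (𝓞 ↥(maximalRealSubfield L)),
      (IrrClass.comap (localPiEquiv L (IsCMField.complexConj L) 3 H v) (clFinChoice P v)).IsConstituentOf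
        (P.finRep.smoothPart.toRepresentation.comp (inclPlace (↥(maximalRealSubfield L)) L (IsCMField.complexConj L) 3 H v)) :=
    fun v => clFinChoice_isConstituentOf_of_nonempty P v (R90.S5.admUnitConstituents_nonempty_of_anisotropic L H μA hanis P v)
  obtain ⟨S, hAEns, hAEs⟩ := hAE
  -- (AE) ROUTES `P` by `ξ` off `S` at the chosen rung-0 data
  have hroute : ∀ v : HeightOneSpectrum (𝓞 ↥(maximalRealSubfield L)), v ∉ S →
      RoutesAt L H hH hHd μω hμu (fun v => (hμZ v).choose) (fun ξ v hns => Classical.choice (hkeys ξ v hns)) μA P ξ v := by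
    intro v hv
    refine ⟨fun hs => ?_, fun hns T a ha h _ => ?_⟩
    · have hc := hAEs v hv hs (clFinChoice P v) (hcons v)
      rwa [cmSplitPacket_members, Set.mem_singleton_iff] at hc
    · exact hAEns v hv hns T a ha h (hμZ v).choose (Classical.choice (hkeys ξ v hns)).1.1 (Classical.choice (hkeys ξ v hns)).1.2
        (Classical.choice (hkeys ξ v hns)).2.1 (Classical.choice (hkeys ξ v hns)).2.2.2 (clFinChoice P v) (hcons v)
  -- ★ S5: a routed `P` has the eigenvalue package of `Π(ξ)`
  obtain ⟨S₀, -, h⟩ := R90.S5.evp_eq_record_of_ae_routesAt L H hH hHd μω hμu (fun v => (hμZ v).choose)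
    (fun ξ v hns => Classical.choice (hkeys ξ v hns)) μA P ξ S hroute
  exact ⟨S₀, h⟩

end Summit.HodgeConjecture.HodgeConjecture.R90.S9

end
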